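import Summits.QuantumFields.BalabanUV.T4Continuum.Support.NE7EJFlatTransport

/-!
# NE7EJFlatDefectLattice — row NE7 (node U5), candidate route HOM, variant H1L-EJ, item EJ-1b′ (T1)–(T3′): LENS 1's (A1) ON EVERY TORUS IN
# KERNEL — on the d = 2 torus `(ℤ∕M)²` cut into cells of `L²` sites, the flat one-step defect form
# `EF^flat(w) := Σ_a |(dw)_a|² − L^{−2}·Σ_P |(d_cQw)(P)|²`, with `(d_cQw)(P) := L^{−2} Σ_{x ∈ B(P)} Σ_{a ⊂ (P)_x} (dw)_a` (Bałaban's (48)),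
# EQUALS `L²·Σ_P Var_{m_P}(dw)` and is therefore `≥ 0` — lens 1's «EF^flat(w) = Σ|F|² − 4Σ_P|AF|² = 4Σ_P Var_{m_P}(F)» at L = 2

Lineage `b2b-balaban-t4-ne7-p2` (CRUX PROVER NE7 #2 = C-HOM°'s kernel hand), generation 81; file 122 (sequel of 119 `NE7EJFlatTransport`, whose
abstract `variance_identity` it instantiates).

SOURCES.  Lens 1 (`t4-ne7-idea-1` gen 67, `DEFECT-VS-HESSIAN-NOTE.md` 9e7cf2b6f8adbc99 §1 (A1)): «With F = dw (fine plaquette curls) and, per coarse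
plaquette P = P_y, the tent multiset m_P = (1,2,1)⊗(1,2,1) on the 3 × 3 fine plaquettes with corners 2y + {0,1,2}² (16 = Σ_a m_P(a); partition of
unity Σ_P m_P(a) = 4 for every a): (d_cQw)(P) = ¼ Σ_a m_P(a) F_a (the tree part of Q is an exact coarse pure gauge, R-calc-40's mechanism line;
the straight part telescopes), hence EF^flat(w) = Σ_a |F_a|² − ¼ Σ_P |¼ Σ_a m_P(a)F_a|² = 4 Σ_P Var_{m_P}(F)».  The identification of `d_c` of
Bałaban's linearised average (42) with the block mean of the fluxes through the `L²` translates `(P)_x`, `x ∈ B(y₀(P))`, of the big plaquette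
is HIS identity (48) [Balaban1985Averaging p. 25], in kernel on `ℤ^d` as `B7Prop1Explicit.corner_cancellation` + `B7Prop1Explicit.stokes`
(tree, paper cell B7); THIS FILE takes the right-hand side of (48) as the DEFINITION of `d_cQw` on the torus (so nothing of (42) is re-derived
here) and proves the variance form for every block size `L` and every partition of the torus into cells of `L²` sites:
* §1 the torus `X = ℤ∕M × ℤ∕M`, 1-forms `w : X → Fin 2 → ℝ`, the plaquette curl `dF w`, the `L × L` square flux `sqFlux L F x = Σ_{i,j<L} F(x + (i,j))`.
* §2 cells: any `blk : X → C` with fibres of size `L²` (Bałaban's blocks when `M = L·M_c`); `dcQ L blk F P := L^{−2} Σ_{x ∈ blk⁻¹P} sqFlux L F x`;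
  the counting weights `mult L blk P a := Σ_{x ∈ blk⁻¹P} Σ_{i,j<L} [x + (i,j) = a]` (lens 1's tent multiset `m_P`; `(1,2,1)⊗(1,2,1)` at L = 2):
  **`sum_mult_row`** `Σ_a m_P(a) = L⁴` (her 16), **`sum_mult_col`** `Σ_P m_P(a) = L²` (her partition of unity 4), **`sum_mult_mul`**
  `Σ_a m_P(a)F_a = Σ_{x ∈ blk⁻¹P} sqFlux F x` (so `d_cQ = L^{−2}·Σ_a m_P(a)F_a` = her `¼Σ m F`).
* §3 `EFflat L blk w := Σ_a (dF w a)² − L^{−2} Σ_P (dcQ P)²`; **`EFflat_eq_variance`**: `EFflat = L²·Σ_P Var_P(dF w)` with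
  `Var_P = variance (m_P∕L⁴)` of file 119, and **`EFflat_nonneg`**; `EFflat_two` (L = 2: `= 4ΣVar`, lens 1's display).
* §4 the concrete Bałaban cells for `M = L·M_c`: `blkB x = (⌊x₁∕L⌋, ⌊x₂∕L⌋) ∈ Fin M_c × Fin M_c`, **`card_fibre_blkB`** `= L²`, and the
  specialisations `EFflatB_eq_variance ∕ EFflatB_nonneg`.

HONEST FRAMING: [folklore] finite bookkeeping on a finite torus; the curl and the square flux are the obvious lattice objects; `d_cQ` is DEFINED by
the right-hand side of Bałaban's (48) (kernel: `B7Prop1Explicit`), not derived from (42) here; the statement is lens 1's (A1) (a d = 2 FLAT ABELIAN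
toy rung, «never the NE7 estimate»), nothing curved, nothing d = 4, nothing of the (A2)–(A3) Fourier reduction; NOT a letter move (PRICING-NE7 v50);
T-50-10 honoured.  NE7 NOT PRINTED ∕ NOT PROVED; spine 0∕9; FIXED FINITE T⁴, rung (B)+1; NOT infinite volume, NOT mass gap, NOT Clay.  HONEST
DEPENDENCY: continuum YM on T⁴ ⇐ BetaPertH ∧ nine spine estimates (0/9 proved); BetaPertH ⇐ (D1) ∧ (D4) ∧ CAP+tail; G-an2-4 gates asym, D1 and NE2/3/4.
-/

noncomputable section

open Finset

namespace Summit.QuantumFields.BalabanUV.T4Continuum.NE7EJFlatDefectLattice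

open NE7EJFlatTransport

variable {M : ℕ} [NeZero M]

/-! ### §1 The torus, the curl, the square flux -/

/-- the d = 2 torus `X = ℤ∕M × ℤ∕M` (sites = plaquettes by their lower-left corner). [folklore] -/
abbrev X (M : ℕ) := ZMod M × ZMod M

/-- unit vectors. [folklore] -/
def ev (μ : Fin 2) : X M := if μ = 0 then (1, 0) else (0, 1)

/-- the plaquette CURL `(dw)(x) = w(x,0) + w(x + e₀,1) − w(x + e₁,0) − w(x,1)`. [folklore] -/
def dF (w : X M → Fin 2 → ℝ) (x : X M) : ℝ := w x 0 + w (x + ev 0) 1 - w (x + ev 1) 0 - w x 1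

/-- the offset `(i, j) ∈ X`. [folklore] -/
def off (i j : ℕ) : X M := ((i : ZMod M), (j : ZMod M))

/-- the flux through the `L × L` square with lower-left corner `x`: `Σ_{i,j<L} F(x + (i,j))` — `Σ_{p ⊂ (p′)_x} A(∂p)` of (48). [folklore] -/
def sqFlux (L : ℕ) (F : X M → ℝ) (x : X M) : ℝ := ∑ i : Fin L, ∑ j : Fin L, F (x + off i j)

/-! ### §2 Cells, the averaged coarse curvature `d_cQ` of (48), and the counting weights -/

section Cells

variable {C : Type*} [Fintype C] [DecidableEq C] (L : ℕ) (blk : X M → C)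

/-- the cell (fibre) of `P`. [folklore] -/
def fib (P : C) : Finset (X M) := univ.filter fun x => blk x = P

/-- **`d_cQ`** — the coarse curvature of the linearised averaged field, BY (48): `(d_cQw)(P) := L^{−2} Σ_{x ∈ B(P)} Σ_{a ⊂ (P)_x} F_a`
(`F = dw`; `B7Prop1Explicit.corner_cancellation` + `.stokes` identify this with `d_c` of Bałaban's (42) linearised). [folklore] -/
def dcQ (F : X M → ℝ) (P : C) : ℝ := (1 / (L : ℝ) ^ 2) * ∑ x ∈ fib blk P, sqFlux L F x

/-- lens 1's tent MULTISET `m_P(a) := #{(x, i, j) : x ∈ B(P), i, j < L, x + (i,j) = a}` (= `(1,2,1)⊗(1,2,1)` around `P` at L = 2). [folklore] -/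
def mult (P : C) (a : X M) : ℝ := ∑ x ∈ fib blk P, ∑ i : Fin L, ∑ j : Fin L, if x + off i j = a then 1 else 0

omit [Fintype C] in
/-- `0 ≤ m_P(a)`. [folklore] -/
theorem mult_nonneg (P : C) (a : X M) : 0 ≤ mult L blk P a :=
  sum_nonneg fun _ _ => sum_nonneg fun _ _ => sum_nonneg fun _ _ => by split_ifs <;> norm_num

omit [Fintype C] in
/-- **row sum**: `Σ_a m_P(a) = |B(P)|·L²` (`= L⁴ = 16` at L = 2 for cells of `L²` sites). [folklore] -/
theorem sum_mult_row (P : C) : ∑ a, mult L blk P a = ((fib blk P).card : ℝ) * (L : ℝ) ^ 2 := by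
  unfold mult
  rw [sum_comm]
  have h1 : ∀ (x : X M) (i j : Fin L), ∑ a : X M, (if x + off (M := M) i j = a then (1:ℝ) else 0) = 1 := fun x i j => by
    rw [sum_ite_eq, if_pos (mem_univ _)]
  have h : ∀ x ∈ fib blk P, ∑ a : X M, ∑ i : Fin L, ∑ j : Fin L, (if x + off (M := M) i j = a then (1:ℝ) else 0) = (L : ℝ) ^ 2 := by
    intro x _
    calc ∑ a : X M, ∑ i : Fin L, ∑ j : Fin L, (if x + off (M := M) i j = a then (1:ℝ) else 0)
        = ∑ i : Fin L, ∑ a : X M, ∑ j : Fin L, (if x + off (M := M) i j = a then (1:ℝ) else 0) := sum_comm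
      _ = ∑ i : Fin L, ∑ j : Fin L, ∑ a : X M, (if x + off (M := M) i j = a then (1:ℝ) else 0) :=
          sum_congr rfl fun i _ => sum_comm
      _ = ∑ i : Fin L, ∑ j : Fin L, (1:ℝ) := by simp only [h1]
      _ = (L : ℝ) ^ 2 := by simp [sq]
  rw [sum_congr rfl h, sum_const, nsmul_eq_mul]

/-- the cells partition the torus: `Σ_P Σ_{x ∈ B(P)} g(x) = Σ_x g(x)`. [folklore] -/
theorem sum_fib (g : X M → ℝ) : ∑ P, ∑ x ∈ fib blk P, g x = ∑ x, g x := by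
  unfold fib
  exact sum_fiberwise univ blk g

/-- **column sum = partition of unity**: `Σ_P m_P(a) = L²` for every fine plaquette `a` (lens 1's `Σ_P m_P(a) = 4` at L = 2). [folklore] -/
theorem sum_mult_col (a : X M) : ∑ P, mult L blk P a = (L : ℝ) ^ 2 := by
  unfold mult
  rw [sum_fib blk, sum_comm]
  have h : ∀ (i j : Fin L), ∑ x : X M, (if x + off (M := M) i j = a then (1:ℝ) else 0) = 1 := fun i j => by
    rw [sum_boole]
    have : (univ.filter fun x : X M => x + off (M := M) i j = a) = {a - off i j} := by
      ext x; simp [eq_sub_iff_add_eq]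
    rw [this, card_singleton]; simp
  calc ∑ i : Fin L, ∑ x : X M, ∑ j : Fin L, (if x + off (M := M) i j = a then (1:ℝ) else 0)
      = ∑ i : Fin L, ∑ j : Fin L, ∑ x : X M, (if x + off (M := M) i j = a then (1:ℝ) else 0) := sum_congr rfl fun i _ => sum_comm
    _ = ∑ i : Fin L, ∑ j : Fin L, (1:ℝ) := by simp only [h]
    _ = (L : ℝ) ^ 2 := by simp [sq]

omit [Fintype C] in
/-- **`Σ_a m_P(a)·F_a = Σ_{x ∈ B(P)} sqFlux F x`** — so `d_cQ(P) = L^{−2}Σ_a m_P(a)F_a` (lens 1's `¼Σ_a m_P(a)F_a`). [folklore] -/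
theorem sum_mult_mul (P : C) (F : X M → ℝ) : ∑ a, mult L blk P a * F a = ∑ x ∈ fib blk P, sqFlux L F x := by
  unfold mult sqFlux
  simp only [sum_mul, ite_mul, one_mul, zero_mul]
  rw [sum_comm]
  refine sum_congr rfl fun x _ => ?_
  calc ∑ a : X M, ∑ i : Fin L, ∑ j : Fin L, (if x + off (M := M) i j = a then F a else 0)
      = ∑ i : Fin L, ∑ a : X M, ∑ j : Fin L, (if x + off (M := M) i j = a then F a else 0) := sum_comm
    _ = ∑ i : Fin L, ∑ j : Fin L, ∑ a : X M, (if x + off (M := M) i j = a then F a else 0) :=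
        sum_congr rfl fun i _ => sum_comm
    _ = ∑ i : Fin L, ∑ j : Fin L, F (x + off i j) := by simp only [sum_ite_eq, mem_univ, if_true]

omit [Fintype C] in
/-- `d_cQ(P) = L^{−2}·Σ_a m_P(a)F_a`. [folklore] -/
theorem dcQ_eq (F : X M → ℝ) (P : C) : dcQ L blk F P = (1 / (L : ℝ) ^ 2) * ∑ a, mult L blk P a * F a := by
  rw [sum_mult_mul]; rfl

end Cells

/-! ### §3 The flat defect form and its variance form -/

section Defect

variable {C : Type*} [Fintype C] [DecidableEq C] (L : ℕ) (blk : X M → C)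

/-- **lens 1's flat one-step defect form** `EF^flat(w) := Σ_a |(dw)_a|² − L^{−2}·Σ_P |(d_cQw)(P)|²` (`κ_c = L^{−2}` in d = 2). [folklore] -/
def EFflat (w : X M → Fin 2 → ℝ) : ℝ := ∑ a, dF w a ^ 2 - (1 / (L : ℝ) ^ 2) * ∑ P, dcQ L blk (dF w) P ^ 2

/-- **(A1) ON EVERY TORUS**: for cells of `L²` sites (`L ≥ 1`), `EF^flat(w) = L²·Σ_P Var_P(dw)`, `Var_P = variance (m_P∕L⁴)` (file 119; probability
weights by `sum_mult_row`). [folklore] -/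
theorem EFflat_eq_variance (hL : 1 ≤ L) (hfib : ∀ P, (fib blk P).card = L ^ 2) (w : X M → Fin 2 → ℝ) :
    EFflat L blk w = (L : ℝ) ^ 2 * ∑ P, variance (fun a => mult L blk P a / (L : ℝ) ^ 4) (dF w) := by
  have hLpos : (0 : ℝ) < L := by exact_mod_cast hL
  have hR : ((L : ℝ) ^ 4) ≠ 0 := by positivity
  have hν : ((L : ℝ) ^ 2) ≠ 0 := by positivity
  have hrow : ∀ P, ∑ a, mult L blk P a = (L : ℝ) ^ 4 := fun P => by
    rw [sum_mult_row, hfib P]; push_cast; ring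
  have key := variance_identity (fun P a => mult L blk P a) hR hν hrow (sum_mult_col L blk) (dF w)
  have hRν : (L : ℝ) ^ 4 / (L : ℝ) ^ 2 = (L : ℝ) ^ 2 := by field_simp
  rw [hRν] at key
  have e1 : ∑ a, dF w a ^ 2 = dF w ⬝ᵥ dF w := by simp [dotProduct, sq]
  have e2 : ∀ P, (1 / (L:ℝ) ^ 2) * dcQ L blk (dF w) P ^ 2 = (L:ℝ) ^ 2 * (∑ a, mult L blk P a / (L:ℝ) ^ 4 * dF w a) ^ 2 := by
    intro P
    rw [dcQ_eq]
    have : ∑ a, mult L blk P a / (L:ℝ) ^ 4 * dF w a = (1 / (L:ℝ) ^ 4) * ∑ a, mult L blk P a * dF w a := by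
      rw [mul_sum]; exact sum_congr rfl fun a _ => by ring
    rw [this]; field_simp
  unfold EFflat
  rw [e1, mul_sum, sum_congr rfl fun P _ => e2 P, ← mul_sum, key]

/-- hence **`0 ≤ EF^flat(w)`** on every torus. [folklore] -/
theorem EFflat_nonneg (hL : 1 ≤ L) (hfib : ∀ P, (fib blk P).card = L ^ 2) (w : X M → Fin 2 → ℝ) : 0 ≤ EFflat L blk w := by
  rw [EFflat_eq_variance L blk hL hfib]
  have hLpos : (0 : ℝ) < L := by exact_mod_cast hL
  have hR : ((L : ℝ) ^ 4) ≠ 0 := by positivity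
  have hrow : ∀ P, ∑ a, mult L blk P a = (L : ℝ) ^ 4 := fun P => by
    rw [sum_mult_row, hfib P]; push_cast; ring
  refine mul_nonneg (by positivity) (sum_nonneg fun P _ => variance_nonneg (fun a => ?_) ?_ _)
  · exact div_nonneg (mult_nonneg L blk P a) (by positivity)
  · rw [← sum_div, hrow P, div_self hR]

/-- lens 1's display at L = 2: `EF^flat = 4·Σ_P Var_{m_P}(F)` with `m_P∕16` the normalised tent. [folklore] -/
theorem EFflat_two (blk : X M → C) (hfib : ∀ P, (fib blk P).card = 4) (w : X M → Fin 2 → ℝ) :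
    EFflat 2 blk w = 4 * ∑ P, variance (fun a => mult 2 blk P a / 16) (dF w) := by
  have h := EFflat_eq_variance 2 blk (by norm_num) (fun P => by rw [hfib P]; norm_num) w
  norm_num at h
  exact h

end Defect

/-! ### §4 Bałaban's cells on the torus of side `L·M_c` -/

section Blocks

variable (L Mc : ℕ) [NeZero L] [NeZero Mc]

/-- Bałaban's cell map on the torus of side `L·M_c`: `x ↦ (⌊x₁∕L⌋, ⌊x₂∕L⌋)`. [folklore] -/
def blkB (x : X (L * Mc)) : Fin Mc × Fin Mc :=
  (⟨x.1.val / L, Nat.div_lt_of_lt_mul (by simpa [mul_comm] using x.1.val_lt)⟩,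
   ⟨x.2.val / L, Nat.div_lt_of_lt_mul (by simpa [mul_comm] using x.2.val_lt)⟩)

/-- the one-dimensional count: `#{k ∈ ℤ∕(L·M_c) : ⌊k∕L⌋ = q} = L`. [folklore] -/
theorem card_filter_div (q : Fin Mc) : (univ.filter fun k : ZMod (L * Mc) => k.val / L = q).card = L := by
  have hL : 0 < L := Nat.pos_of_ne_zero (NeZero.ne L)
  have hlt : ∀ r : Fin L, L * q + r < L * Mc := fun r => by
    calc L * q + r < L * q + L := by have := r.isLt; omega
      _ = L * (q + 1) := by ring
      _ ≤ L * Mc := Nat.mul_le_mul_left _ (by have := q.isLt; omega)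
  -- the bijection `k ↦ k.val % L` onto `Fin L`, inverse `r ↦ L·q + r`
  have hcard : (univ.filter fun k : ZMod (L * Mc) => k.val / L = q).card = (univ : Finset (Fin L)).card := by
    refine card_bij' (fun k _ => (⟨k.val % L, Nat.mod_lt _ hL⟩ : Fin L)) (fun r _ => ((L * q + r : ℕ) : ZMod (L * Mc))) ?_ ?_ ?_ ?_
    · intro k _; exact mem_univ _
    · intro r _
      simp only [mem_filter, mem_univ, true_and]
      rw [ZMod.val_natCast, Nat.mod_eq_of_lt (hlt r), Nat.add_comm, Nat.add_mul_div_left _ _ hL, Nat.div_eq_of_lt r.isLt, zero_add]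
    · intro k hk
      simp only [mem_filter, mem_univ, true_and] at hk
      have h := Nat.div_add_mod k.val L
      rw [hk] at h
      have : ((L * q + k.val % L : ℕ) : ZMod (L * Mc)) = (k.val : ZMod (L * Mc)) := by rw [h]
      simp only
      rw [this, ZMod.natCast_zmod_val]
    · intro r _
      ext
      simp only [ZMod.val_natCast, Nat.mod_eq_of_lt (hlt r)]
      rw [Nat.add_comm, Nat.add_mul_mod_self_left, Nat.mod_eq_of_lt r.isLt]
  rw [hcard, card_univ, Fintype.card_fin]

/-- **the cells have `L²` sites**: `#blkB⁻¹(P) = L²`. [folklore] -/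
theorem card_fibre_blkB (P : Fin Mc × Fin Mc) : (fib (blkB L Mc) P).card = L ^ 2 := by
  unfold fib blkB
  have h : (univ.filter fun x : X (L * Mc) => blkB L Mc x = P)
      = (univ.filter fun k : ZMod (L * Mc) => k.val / L = P.1) ×ˢ (univ.filter fun k : ZMod (L * Mc) => k.val / L = P.2) := by
    ext x
    simp only [blkB, mem_filter, mem_univ, true_and, mem_product, Prod.ext_iff, Fin.ext_iff]
  unfold blkB at h
  rw [h, card_product, card_filter_div, card_filter_div, sq]

/-- **(A1) for Bałaban's cells**: on the torus of side `L·M_c`, `EF^flat = L²·Σ_P Var_P(dw) ≥ 0`. [folklore] -/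
theorem EFflatB_eq_variance (w : X (L * Mc) → Fin 2 → ℝ) :
    EFflat L (blkB L Mc) w = (L : ℝ) ^ 2 * ∑ P, variance (fun a => mult L (blkB L Mc) P a / (L : ℝ) ^ 4) (dF w) ∧
    0 ≤ EFflat L (blkB L Mc) w :=
  have hL : 1 ≤ L := Nat.pos_of_ne_zero (NeZero.ne L)
  ⟨EFflat_eq_variance L _ hL (card_fibre_blkB L Mc) w, EFflat_nonneg L _ hL (card_fibre_blkB L Mc) w⟩

end Blocks

end Summit.QuantumFields.BalabanUV.T4Continuum.NE7EJFlatDefectLattice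

end

-- Build-lane re-trigger (lineage t4-ne7-p2, gen 85, 2026-08-24): comment-only re-land of the tree bytes e97cb2aa6badd0da (file 122, p370960, gen 81);
-- every declaration byte-identical.  Never built (`ops/buildfix/UNBUILT-ACCEPTED-20260824T1600.txt` l.608: last build event rc 75 NO-HOST, attempt 63);
-- the staged 125 v2 `NE7EJFlatBloch` and 131 `NE7EJFlatBlochB` import it.  Cf. ops-buildfix-2's comment-only re-land p372431 of `B7Prop4Flat`.
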